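import Literature.NumberTheory.GaloisRepresentations.PowerSeriesTopNilpotentEvalZeros
import HarnessLib

/-!
# Division by `T − b` in `A⟦T⟧` through the `(p)`-adic evaluation: `f = (T − b)·q + f(b)`, `(T − b) ∣ f ↔ f(b) = 0`,
# `ker (tEval b) = (T − b)`, and the HEIGHT-TWO DIVISION `d₂·y₁ = w(T − b)·y₂, d₂(b) ≠ 0 ⟹ (T − b) ∣ y₁` (de Shalit II §4.12 (29)→(32))

Washington, *Introduction to Cyclotomic Fields* (1997), §7.1 Prop. 7.2 (Weierstrass DIVISION: `f = g·q + r`, `deg r < deg ḡ`) at the distinguished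
polynomial `g = T − b` of degree one (`b ∈ 𝔪`): the remainder is the constant `f(b)`, so `A⟦T⟧/(T − b) ≅ A` by evaluation; de Shalit, *Iwasawa theory
of elliptic curves with complex multiplication* (1987), II §4.12 (29)–(32): the cocycle `μ_𝔞(σ_𝔠 − N𝔠) = μ_𝔠(σ_𝔞 − N𝔞)` is divided by `σ_{𝔞₁} − N𝔞₁`
using an auxiliary `𝔞₂` with `(σ_{𝔞₁} − N𝔞₁, σ_{𝔞₂} − N𝔞₂)` "relatively prime" (height two) — on the series side, with `σ_{𝔞₁} − N𝔞₁ = w·(T − b)`,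
this is: `(T − b) ∣ (σ_{𝔞₂} − N𝔞₂)·μ_{𝔞₁}` and `(σ_{𝔞₂} − N𝔞₂)(b) ≠ 0` force `(T − b) ∣ μ_{𝔞₁}`.  Built on `PowerSeriesTopNilpotentIntertwine` (`tEval`)
and Mathlib's `PowerSeries.eq_mul_weierstrassDiv_add_weierstrassMod`; everything PROVED (0 sorry, no definitions):

* §1 `map_residue_X_sub_C` (`(T − b) mod 𝔪 = T`), `map_residue_X_sub_C_ne_zero`, `order_map_residue_X_sub_C` (`= 1`);
* §2 ★ `eq_X_sub_C_mul_weierstrassDiv_add_C_tEval` — **`f = (T − b)·(f /ʷ (T − b)) + C(f(b))`** (the Weierstrass remainder modulo a linear distinguished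
  polynomial is the VALUE); ★ `X_sub_C_dvd_iff_tEval_eq_zero` (**`(T − b) ∣ f ↔ f(b) = 0`**), ★ `ker_tEvalHom_eq_span` (**`ker tEval_b = (T − b)`**: `A⟦T⟧/(T − b) ≅ A`);
* §3 (`A` a domain) ★★ `X_sub_C_dvd_of_mul_eq_mul` / **`exists_eq_mul_of_mul_eq_mul`** — if `d₂·y₁ = (w·(T − b))·y₂` with `d₂(b) ≠ 0` then
  `y₁ = (w·(T − b))·L` for some `L` (`w` a unit): the series-side division step of de Shalit II §4.12.

## References
* L. C. Washington, *Introduction to Cyclotomic Fields*, 2nd ed. (1997), §7.1 Prop. 7.2, Thm. 7.3. [Washington1997]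
* E. de Shalit, *Iwasawa theory of elliptic curves with complex multiplication* (1987), Ch. II §4.12 (29)–(32). [deShalit1987]
-/

noncomputable section

namespace Literature.NumberTheory.GaloisRepresentations

namespace LubinTate

open PowerSeries

variable {A : Type*} [CommRing A] [IsLocalRing A] {p : A} [IsAdicComplete (Ideal.span {p}) A]
  {b : A} (hb : b ∈ Ideal.span {p}) (hp : p ∈ IsLocalRing.maximalIdeal A)

/-! ### §1. `T − b` reduces to `T` modulo `𝔪` -/

omit [IsAdicComplete (Ideal.span {p}) A] in
include hb hp in
/-- `b ∈ 𝔪_A` (as `b ∈ (p) ⊆ 𝔪`). [cite: Washington1997, §7.1] -/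
theorem mem_maximalIdeal_of_mem_span : b ∈ IsLocalRing.maximalIdeal A :=
  (Ideal.span_singleton_le_iff_mem (IsLocalRing.maximalIdeal A)).mpr hp hb

omit [IsAdicComplete (Ideal.span {p}) A] in
include hb hp in
/-- **`(T − b) mod 𝔪 = T`** in `𝓀⟦T⟧`. [cite: Washington1997, §7.1] -/
theorem map_residue_X_sub_C :
    (PowerSeries.X - PowerSeries.C b : PowerSeries A).map (IsLocalRing.residue A) = PowerSeries.X := by
  rw [map_sub, PowerSeries.map_X, PowerSeries.map_C, (IsLocalRing.residue_eq_zero_iff b).mpr (mem_maximalIdeal_of_mem_span hb hp), map_zero,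
    sub_zero]

omit [IsAdicComplete (Ideal.span {p}) A] in
include hb hp in
/-- `(T − b) mod 𝔪 ≠ 0`. [cite: Washington1997, §7.1] -/
theorem map_residue_X_sub_C_ne_zero :
    (PowerSeries.X - PowerSeries.C b : PowerSeries A).map (IsLocalRing.residue A) ≠ 0 := by
  rw [map_residue_X_sub_C hb hp]
  exact PowerSeries.X_ne_zero

omit [IsAdicComplete (Ideal.span {p}) A] in
include hb hp in
/-- The reduced order of `T − b` is `1` (a distinguished polynomial of degree one). [cite: Washington1997, §7.1] -/
theorem order_map_residue_X_sub_C :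
    ((PowerSeries.X - PowerSeries.C b : PowerSeries A).map (IsLocalRing.residue A)).order.toNat = 1 := by
  rw [map_residue_X_sub_C hb hp, PowerSeries.order_X]
  rfl

/-! ### §2. Weierstrass division by `T − b`: the remainder is the value `f(b)` -/

variable [IsAdicComplete (IsLocalRing.maximalIdeal A) A]

omit [IsAdicComplete (Ideal.span {p}) A] in
include hb hp in
/-- The Weierstrass remainder modulo `T − b` is a constant polynomial. [cite: Washington1997, §7.1 Prop. 7.2] -/
theorem weierstrassMod_X_sub_C_eq_C (f : PowerSeries A) :
    f %ʷ (PowerSeries.X - PowerSeries.C b) = Polynomial.C ((f %ʷ (PowerSeries.X - PowerSeries.C b)).coeff 0) := by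
  refine Polynomial.eq_C_of_degree_le_zero ?_
  have h := PowerSeries.degree_weierstrassMod_lt f (PowerSeries.X - PowerSeries.C b : PowerSeries A)
  rw [order_map_residue_X_sub_C hb hp, Nat.cast_one] at h
  exact Nat.WithBot.lt_one_iff_le_zero.mp h

include hp in
/-- ★ **`f = (T − b)·(f /ʷ (T − b)) + C(f(b))`**: dividing by the linear distinguished polynomial `T − b` leaves the VALUE `f(b)` as remainder.
[cite: Washington1997, §7.1 Prop. 7.2] -/
theorem eq_X_sub_C_mul_weierstrassDiv_add_C_tEval (f : PowerSeries A) :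
    f = (PowerSeries.X - PowerSeries.C b) * (f /ʷ (PowerSeries.X - PowerSeries.C b)) + PowerSeries.C (tEval hb f) := by
  have hdiv := f.eq_mul_weierstrassDiv_add_weierstrassMod (map_residue_X_sub_C_ne_zero hb hp)
  rw [weierstrassMod_X_sub_C_eq_C hb hp f, Polynomial.coe_C] at hdiv
  have hval : tEval hb f = (f %ʷ (PowerSeries.X - PowerSeries.C b)).coeff 0 := by
    conv_lhs => rw [hdiv]
    rw [tEval_add, mul_comm, tEval_mul_X_sub_C, zero_add, tEval_C]
  rw [hval]
  exact hdiv

include hp in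
/-- ★ **`(T − b) ∣ f ↔ f(b) = 0`.** [cite: Washington1997, §7.1 Prop. 7.2] -/
theorem X_sub_C_dvd_iff_tEval_eq_zero (f : PowerSeries A) : (PowerSeries.X - PowerSeries.C b) ∣ f ↔ tEval hb f = 0 := by
  constructor
  · rintro ⟨q, rfl⟩
    rw [mul_comm, tEval_mul_X_sub_C]
  · intro h0
    refine ⟨f /ʷ (PowerSeries.X - PowerSeries.C b), ?_⟩
    conv_lhs => rw [eq_X_sub_C_mul_weierstrassDiv_add_C_tEval hb hp f]
    rw [h0, map_zero, add_zero]

include hp in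
/-- ★ **`ker tEval_b = (T − b)`**: evaluation at `b` identifies `A⟦T⟧/(T − b)` with `A`. [cite: Washington1997, §7.1 Prop. 7.2] -/
theorem ker_tEvalHom_eq_span : RingHom.ker (tEvalHom hb) = Ideal.span {PowerSeries.X - PowerSeries.C b} := by
  ext f
  rw [RingHom.mem_ker, tEvalHom_apply, Ideal.mem_span_singleton, X_sub_C_dvd_iff_tEval_eq_zero hb hp]

omit [IsLocalRing A] [IsAdicComplete (IsLocalRing.maximalIdeal A) A] in
/-- `tEvalHom` is surjective (`C s ↦ s`). [cite: Washington1997, §7.1] -/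
theorem tEvalHom_surjective : Function.Surjective (tEvalHom hb) := fun s => ⟨PowerSeries.C s, tEval_C hb s⟩

/-! ### §3. The height-two division (de Shalit II §4.12 (29)→(32), series side) -/

include hp in
/-- ★★ **If `d₂·y₁ = (w·(T − b))·y₂` and `d₂(b) ≠ 0` (`A` a domain), then `(T − b) ∣ y₁`** (evaluate at `b`: `d₂(b)·y₁(b) = 0`).
[cite: deShalit1987, Ch. II §4.12 (29)–(32)] -/
theorem X_sub_C_dvd_of_mul_eq_mul [IsDomain A] {d₂ y₁ y₂ w : PowerSeries A}
    (h : d₂ * y₁ = w * (PowerSeries.X - PowerSeries.C b) * y₂) (hd₂ : tEval hb d₂ ≠ 0) :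
    (PowerSeries.X - PowerSeries.C b) ∣ y₁ := by
  rw [X_sub_C_dvd_iff_tEval_eq_zero hb hp]
  have hev := congrArg (tEval hb) h
  rw [tEval_mul, tEval_mul, tEval_mul_X_sub_C, zero_mul] at hev
  exact (mul_eq_zero.mp hev).resolve_left hd₂

include hp in
/-- ★★ **DIVISION STEP** (de Shalit II §4.12 (32) on the series side): if `d₂·y₁ = d₁·y₂` with `d₁ = w·(T − b)`, `w ∈ A⟦T⟧^×`, `d₂(b) ≠ 0` (`A` a domain),
then **`y₁ = d₁·L` for some `L ∈ A⟦T⟧`** — the cocycle `𝔞 ↦ μ_𝔞` is divisible by `σ_{𝔞₁} − N𝔞₁`. [cite: deShalit1987, Ch. II §4.12 (29)–(32)] -/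
theorem exists_eq_mul_of_mul_eq_mul [IsDomain A] {d₁ d₂ y₁ y₂ w : PowerSeries A} (hw : IsUnit w)
    (hd₁ : d₁ = w * (PowerSeries.X - PowerSeries.C b)) (h : d₂ * y₁ = d₁ * y₂) (hd₂ : tEval hb d₂ ≠ 0) :
    ∃ L : PowerSeries A, y₁ = d₁ * L := by
  rw [hd₁] at h
  obtain ⟨q, hq⟩ := X_sub_C_dvd_of_mul_eq_mul hb hp h hd₂
  refine ⟨↑hw.unit⁻¹ * q, ?_⟩
  rw [hd₁, hq, mul_assoc, mul_left_comm (PowerSeries.X - PowerSeries.C b), ← mul_assoc, IsUnit.mul_val_inv, one_mul]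

omit [IsLocalRing A] [IsAdicComplete (Ideal.span {p}) A] [IsAdicComplete (IsLocalRing.maximalIdeal A) A] in
/-- **Uniqueness of the quotient**: `d₁ = w·(T − b)` is a non-zero-divisor when `A` is a domain. [cite: deShalit1987, Ch. II §4.12 (32)] -/
theorem mem_nonZeroDivisors_of_eq_unit_mul_X_sub_C [IsDomain A] {b : A} {d₁ w : PowerSeries A} (hw : IsUnit w)
    (hd₁ : d₁ = w * (PowerSeries.X - PowerSeries.C b)) : d₁ ∈ nonZeroDivisors (PowerSeries A) := by
  rw [hd₁]
  refine mul_mem (IsUnit.mem_nonZeroDivisors hw) (mem_nonZeroDivisors_of_ne_zero ?_)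
  intro h0
  have h1 := congrArg (PowerSeries.coeff 1) h0
  rw [map_sub, PowerSeries.coeff_one_X, PowerSeries.coeff_C, if_neg one_ne_zero, sub_zero, map_zero] at h1
  exact one_ne_zero h1

end LubinTate

end Literature.NumberTheory.GaloisRepresentations
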